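import Summits.QuantumFields.YangMills.Theorems.UnitScaleTiltProp7SectET3WilsonHessianT3RealityRows
import Summits.QuantumFields.YangMills.Theorems.UnitScaleTiltProp7TPrintDefs
import Mathlib.Analysis.Complex.RealDeriv
import HarnessLib

/-!
# Route `UnitScaleTilt`, crux «MinimiserStabilityRegPr» (stmt-QuantumFields-19200, stub EX) ∕ (O″χ) B0 (stmt-QuantumFields-20520), node N06(d = 3), route (α) —
# LAYER 0, ROWS OF BRICK L0b, PART 3 (def-free): **THE NORMALISATION ROW `cη` — THE ROUTE'S WILSON-ACTION HESSIAN ALONG THE CHART OF RECORD IS `cη·⟨Y, Δ^η(U₀)Y⟩`**: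
# `∂²_t A(e^{itY}U₀)|_{t=0} = cη · Re⟪toL2 Y, DeltaEta U₀ (toL2 Y)⟫` for Hermitian traceless exponent fields `Y` (`cη = η²∕(2c₀)`, ★★OWNER ACK 32: carried by name), together with the two
# identifications it rests on: `actionRe (bgUnits U) = wilsonAction4 U` (print's symmetrised complexified action IS the route's action on `SU(2)` fields) and
# `bgUnits (emb15 U₀ (expHermField (t•Y))) = chartU U₀ (t•iY)` (the route's (15)∕(112) configuration IS brick L0b's chart at `X = itY`)

Cell `ym-inputs` (desk `pub/ym-inputs`, INPUT-LIST.md v6 §4 row p01; memo `pub/ym-inputs/DEFINER-MEMO-T3.md` §2 L0b «rows owed: the `cη` Hessian identity»).  THEOREMS ONLY (0 `def`, 0 `sorry`);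
`--supports stmt-QuantumFields-20520 --as helper`; count-neutral.  YM₃ on T³ is ladder rung R3, NOT the Clay problem; nothing here is a claim about a stub, a crux, d = 4 or the mass gap.

WHAT IS PROVED (member `F`, `K`; `U U₀ : GaugeField (F.P K) 0 SU(2)`; `Y` with `∀ b, (Y b).IsHermitian ∧ tr (Y b) = 0`): `val_plaqU_bgUnits` (`W(∂p)` of `bgUnits U` is the route's `plaqHol U p`),
★★`actionRe_bgUnits` (`actionRe (bgUnits U) = ↑(wilsonAction4 U)`), ★`bgUnits_emb15_expHermField` (the route's chart point is `chartU U₀ (t • iY)`), `wilsonAction4_emb15_eq_re`,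
`iteratedDeriv_two_actionRe_line` (`∂²_z A(chartU U₀ (zZ))|₀ = hessFormRe U₀ Z Z`), ★★`iteratedDeriv_two_wilsonAction4_emb15` (`∂²_t A(e^{itY}U₀)|₀ = −Re hessFormRe U₀ Y Y`),
`inner_toL2_DeltaEta_toL2`, ★★★`iteratedDeriv_two_wilsonAction4_eq_cη_inner` (the `cη` row).
HONEST SCOPE.  Calculus bookkeeping (Mathlib `HasDerivAt.real_of_complex`, `iteratedFDeriv_comp_right`); no estimate, no positivity; nothing of print asserted.

References: T. Bałaban, CMP **99** (1985) 389–434 [Balaban1985BackgroundPropagators] ((3.7) p.391, (3.10)–(3.12) p.392); CMP **109** (1987) 249–301 [Balaban1987RG1] ((0.2) p.252); CMP **102**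
(1985) 277–309 [Balaban1985Variational] ((15) p.280, (112) p.294).
-/

set_option autoImplicit false

noncomputable section

open scoped InnerProductSpace ComplexConjugate Matrix.Norms.L2Operator BigOperators

namespace Summit.QuantumFields.YangMills.Theorems.Prop7SectET3WilsonHessian

open Literature.MathematicalPhysics.QuantumFieldTheory.Balaban1983to89
open Literature.MathematicalPhysics.QuantumFieldTheory.Balaban1983to89.T3ContinuumYM3Torus
open NormedSpace (exp)
open T3SectALandauChart (bgUnits emb15 eta eta_pos)
open B10Eq27TorusAxialLog (holT unitsField toUField val_holT_unitsField holT_toUField val_suIncl holT_plaqWord_eq_plaqHol)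
open B7Prop1Explicit (expUnit val_expUnit plaqWord)
open B11Eq103H1Complex (BondL2K)
open Summit.QuantumFields.YangMills.Theorems.Prop7SectET3Transport (periodsT3)
open Summit.QuantumFields.YangMills.Theorems.Prop7SectET3HilbertLetters (W₂ toL2)
open Summit.QuantumFields.YangMills.Theorems.Prop7TPrint (expHerm expHermField coe_expHerm expHermField_apply)

variable {F : T3Family} {K : ℕ}

/-! ## §1 Print's symmetrised complexified action IS the route's Wilson action on `SU(2)` fields -/

/-- The plaquette variable of `bgUnits U` is the route's `plaqHol U p`, as a matrix. [cite: Balaban1985Averaging, (9) p.19] -/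
theorem val_plaqU_bgUnits (U : GaugeField (F.P K) 0 (Matrix.specialUnitaryGroup (Fin 2) ℂ)) (p : Plaq (F.P K) 0) :
    ((plaqU F K (bgUnits F K U) p : (Matrix (Fin 2) (Fin 2) ℂ)ˣ) : Matrix (Fin 2) (Fin 2) ℂ) =
      ((GaugeField.plaqHol U p : Matrix.specialUnitaryGroup (Fin 2) ℂ) : Matrix (Fin 2) (Fin 2) ℂ) := by
  rw [plaqU_def, show bgUnits F K U = unitsField (toUField U) from rfl, val_holT_unitsField, holT_toUField, val_suIncl, holT_plaqWord_eq_plaqHol]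

/-- ★★ **`actionRe (bgUnits U) = wilsonAction4 U`**: on `SU(2)`-valued fields `tr W(∂p)⁻¹ = conj tr W(∂p)`, so `1 − ¼(tr W + tr W⁻¹) = 1 − ½ Re tr W = 1 − reTr W(∂p)` (normalised trace).
[cite: Balaban1985BackgroundPropagators, (3.7) p.391; Balaban1987RG1, (0.2) p.252] -/
theorem actionRe_bgUnits (U : GaugeField (F.P K) 0 (Matrix.specialUnitaryGroup (Fin 2) ℂ)) :
    actionRe F K (bgUnits F K U) = ((wilsonAction4 U : ℝ) : ℂ) := by
  rw [actionRe_def, wilsonAction4, wilsonAction, Complex.ofReal_sum]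
  refine Finset.sum_congr rfl fun p _ => ?_
  set M : Matrix (Fin 2) (Fin 2) ℂ := ((GaugeField.plaqHol U p : Matrix.specialUnitaryGroup (Fin 2) ℂ) : Matrix (Fin 2) (Fin 2) ℂ) with hM_def
  have hM : star M * M = 1 := Matrix.mem_unitaryGroup_iff'.1 (GaugeField.plaqHol U p).2.1
  have hinv : (((plaqU F K (bgUnits F K U) p)⁻¹ : (Matrix (Fin 2) (Fin 2) ℂ)ˣ) : Matrix (Fin 2) (Fin 2) ℂ) = star M := by
    rw [Matrix.coe_units_inv, val_plaqU_bgUnits]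
    exact Matrix.inv_eq_left_inv hM
  have hre : reTr (GaugeField.plaqHol U p) = M.trace.re / (Fintype.card (Fin 2) : ℝ) := rfl
  rw [hinv, val_plaqU_bgUnits, ← hM_def, hre, Fintype.card_fin, Matrix.star_eq_conjTranspose, Matrix.trace_conjTranspose, Complex.star_def, Complex.add_conj]
  push_cast
  ring

/-! ## §2 The route's chart point is brick L0b's chart at `X = itY` -/

/-- ★ **`bgUnits (emb15 U₀ (expHermField (t • Y))) = chartU U₀ (t • iY)`** for Hermitian traceless `Y` (the junk branch of `expHerm` is not met).
[cite: Balaban1985Variational, (15) p.280, (112) p.294; Balaban1985BackgroundPropagators, (3.6) p.391] -/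
theorem bgUnits_emb15_expHermField (U₀ : GaugeField (F.P K) 0 (Matrix.specialUnitaryGroup (Fin 2) ℂ)) {Y : PBond (F.P K) 0 → Matrix (Fin 2) (Fin 2) ℂ}
    (hY : ∀ b, (Y b).IsHermitian ∧ Matrix.trace (Y b) = 0) (t : ℝ) :
    bgUnits F K (emb15 U₀ (expHermField (fun b => (t : ℂ) • Y b))) = chartU F K U₀ ((t : ℂ) • (Complex.I • Y)) := by
  funext b
  have hYt : ((t : ℂ) • Y b).IsHermitian ∧ Matrix.trace ((t : ℂ) • Y b) = 0 :=
    ⟨(hY b).1.smul (by rw [IsSelfAdjoint, Complex.star_def, Complex.conj_ofReal]), by rw [Matrix.trace_smul, (hY b).2, smul_zero]⟩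
  ext1
  rw [val_chartU, show ((bgUnits F K (emb15 U₀ (expHermField fun b => (t : ℂ) • Y b)) b : (Matrix (Fin 2) (Fin 2) ℂ)ˣ) : Matrix (Fin 2) (Fin 2) ℂ) =
      ((emb15 U₀ (expHermField fun b => (t : ℂ) • Y b) b : Matrix.specialUnitaryGroup (Fin 2) ℂ) : Matrix (Fin 2) (Fin 2) ℂ) from rfl,
    show ((bgUnits F K U₀ b : (Matrix (Fin 2) (Fin 2) ℂ)ˣ) : Matrix (Fin 2) (Fin 2) ℂ) = ((U₀ b : Matrix.specialUnitaryGroup (Fin 2) ℂ) : Matrix (Fin 2) (Fin 2) ℂ) from rfl,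
    emb15, Submonoid.coe_mul, expHermField_apply, coe_expHerm hYt, Pi.smul_apply, Pi.smul_apply, smul_comm (t : ℂ) Complex.I (Y b)]

/-- The route's Wilson action at the chart point is the real part of print's complexified action along brick L0b's chart. [cite: Balaban1987RG1, (0.2) p.252] -/
theorem wilsonAction4_emb15_eq_re (U₀ : GaugeField (F.P K) 0 (Matrix.specialUnitaryGroup (Fin 2) ℂ)) {Y : PBond (F.P K) 0 → Matrix (Fin 2) (Fin 2) ℂ}
    (hY : ∀ b, (Y b).IsHermitian ∧ Matrix.trace (Y b) = 0) (t : ℝ) :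
    wilsonAction4 (emb15 U₀ (expHermField (fun b => (t : ℂ) • Y b))) = (actionRe F K (chartU F K U₀ ((t : ℂ) • (Complex.I • Y)))).re := by
  rw [← bgUnits_emb15_expHermField U₀ hY, actionRe_bgUnits, Complex.ofReal_re]

/-! ## §3 The second variation along the chart -/

/-- `∂²_z A(chartU U₀ (z • Z))|_{z=0} = hessFormRe U₀ Z Z` (complex line through `0`). [cite: Balaban1985BackgroundPropagators, (3.7) p.391] -/
theorem iteratedDeriv_two_actionRe_line (U₀ : GaugeField (F.P K) 0 (Matrix.specialUnitaryGroup (Fin 2) ℂ)) (Z : PBond (F.P K) 0 → Matrix (Fin 2) (Fin 2) ℂ) :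
    iteratedDeriv 2 (fun z : ℂ => actionRe F K (chartU F K U₀ (z • Z))) 0 = hessFormRe F K U₀ Z Z := by
  have hcomp : (fun z : ℂ => actionRe F K (chartU F K U₀ (z • Z))) =
      (fun X : PBond (F.P K) 0 → Matrix (Fin 2) (Fin 2) ℂ => actionRe F K (chartU F K U₀ X)) ∘ (ContinuousLinearMap.toSpanSingleton ℂ Z) := by
    funext z
    rw [Function.comp_apply, ContinuousLinearMap.toSpanSingleton_apply]
  rw [iteratedDeriv_eq_iteratedFDeriv, hcomp, (ContinuousLinearMap.toSpanSingleton ℂ Z).iteratedFDeriv_comp_right (contDiff_actionRe_chartU U₀) 0 (by exact_mod_cast le_top),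
    ContinuousMultilinearMap.compContinuousLinearMap_apply, map_zero, iteratedFDeriv_two_apply, ContinuousLinearMap.toSpanSingleton_apply, one_smul]
  rfl

/-- The complexified action along a complex line is smooth. [folklore] -/
theorem contDiff_actionRe_line (U₀ : GaugeField (F.P K) 0 (Matrix.specialUnitaryGroup (Fin 2) ℂ)) (Z : PBond (F.P K) 0 → Matrix (Fin 2) (Fin 2) ℂ) :
    ContDiff ℂ ⊤ (fun z : ℂ => actionRe F K (chartU F K U₀ (z • Z))) := by
  have h := (contDiff_actionRe_chartU U₀).comp (ContinuousLinearMap.toSpanSingleton ℂ Z).contDiff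
  simpa only [Function.comp_def, ContinuousLinearMap.toSpanSingleton_apply] using h

/-- ★★ **THE SECOND VARIATION OF THE ROUTE'S WILSON ACTION ALONG THE CHART: `∂²_t A(e^{itY}U₀)|_{t=0} = −Re D²(A∘chartU U₀)(0)[Y, Y]`** for Hermitian traceless `Y`.
[cite: Balaban1985BackgroundPropagators, (3.7) p.391, (3.12) p.392; Balaban1987RG1, (0.2) p.252] -/
theorem iteratedDeriv_two_wilsonAction4_emb15 (U₀ : GaugeField (F.P K) 0 (Matrix.specialUnitaryGroup (Fin 2) ℂ)) {Y : PBond (F.P K) 0 → Matrix (Fin 2) (Fin 2) ℂ}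
    (hY : ∀ b, (Y b).IsHermitian ∧ Matrix.trace (Y b) = 0) :
    iteratedDeriv 2 (fun t : ℝ => wilsonAction4 (emb15 U₀ (expHermField (fun b => (t : ℂ) • Y b)))) 0 = -(hessFormRe F K U₀ Y Y).re := by
  set h : ℂ → ℂ := fun z => actionRe F K (chartU F K U₀ (z • (Complex.I • Y))) with hh_def
  have hh : ContDiff ℂ ⊤ h := contDiff_actionRe_line U₀ _
  have hg : (fun t : ℝ => wilsonAction4 (emb15 U₀ (expHermField (fun b => (t : ℂ) • Y b)))) = fun t : ℝ => (h t).re :=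
    funext fun t => wilsonAction4_emb15_eq_re U₀ hY t
  have hd : Differentiable ℂ h := hh.differentiable (by simp)
  have hh2 : ContDiff ℂ 2 h := hh.of_le le_top
  have hd' : Differentiable ℂ (deriv h) := by
    rw [← iteratedDeriv_one]
    exact hh2.differentiable_iteratedDeriv 1 (by exact_mod_cast Nat.one_lt_two)
  have hd1 : deriv (fun t : ℝ => (h t).re) = fun t : ℝ => (deriv h t).re := funext fun t => ((hd (t : ℂ)).hasDerivAt.real_of_complex).deriv
  have h2 : HasDerivAt (fun t : ℝ => (deriv h t).re) (deriv (deriv h) ((0 : ℝ) : ℂ)).re 0 := (hd' ((0 : ℝ) : ℂ)).hasDerivAt.real_of_complex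
  rw [hg, iteratedDeriv_succ, iteratedDeriv_one, hd1, h2.deriv, Complex.ofReal_zero, ← iteratedDeriv_one (f := h), ← iteratedDeriv_succ, hh_def,
    iteratedDeriv_two_actionRe_line, map_smul, map_smul, FunLike.coe_smul, Pi.smul_apply, smul_eq_mul, smul_eq_mul, ← mul_assoc, Complex.I_mul_I,
    neg_one_mul, Complex.neg_re]

/-! ## §4 The `cη` row -/

variable {n : ℕ} {c₀ : ℝ} [Fact (0 < c₀)]

/-- `⟪toL2 Y, Δ^η(U₀)(toL2 Y)⟫ = (−2c₀∕η²)·conj hessFormRe U₀ Yᴴ Y`. [cite: Balaban1985BackgroundPropagators, (3.11)–(3.12) p.392] -/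
theorem inner_toL2_DeltaEta_toL2 (U₀ : GaugeField (F.P K) 0 (Matrix.specialUnitaryGroup (Fin 2) ℂ)) (Y : PBond (F.P K) 0 → Matrix (Fin 2) (Fin 2) ℂ) :
    ⟪toL2 F K c₀ Y, DeltaEta F n K c₀ U₀ (toL2 F K c₀ Y)⟫_ℂ = ((-(2 * (c₀ : ℂ)) / (((eta F n K : ℝ) : ℂ)) ^ 2)) * conj (hessFormRe F K U₀ (star Y) Y) := by
  have hc : conj ((-(2 * (c₀ : ℂ)) / (((eta F n K : ℝ) : ℂ)) ^ 2)) = (-(2 * (c₀ : ℂ)) / (((eta F n K : ℝ) : ℂ)) ^ 2) := by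
    rw [map_div₀, map_neg, map_mul, map_pow, map_ofNat, Complex.conj_ofReal, Complex.conj_ofReal]
  rw [← inner_conj_symm, inner_DeltaEta_left, hessSesqRe_apply, LinearEquiv.symm_apply_apply, map_mul, hc]

/-- ★★★ **THE `cη` ROW: `∂²_t A(e^{itY}U₀)|_{t=0} = cη · Re⟪toL2 Y, Δ^η(U₀)(toL2 Y)⟫`** for Hermitian traceless exponent fields `Y`, `cη = η²∕(2c₀)` — the route's Wilson-action Hessian along
the chart of record IS print's `⟨Y, Δ(U₀)Y⟩` up to the named constant. [cite: Balaban1985BackgroundPropagators, (3.10)–(3.12) p.392; Balaban1987RG1, (0.2) p.252] -/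
theorem iteratedDeriv_two_wilsonAction4_eq_cη_inner (U₀ : GaugeField (F.P K) 0 (Matrix.specialUnitaryGroup (Fin 2) ℂ)) {Y : PBond (F.P K) 0 → Matrix (Fin 2) (Fin 2) ℂ}
    (hY : ∀ b, (Y b).IsHermitian ∧ Matrix.trace (Y b) = 0) :
    iteratedDeriv 2 (fun t : ℝ => wilsonAction4 (emb15 U₀ (expHermField (fun b => (t : ℂ) • Y b)))) 0 =
      cη F n K c₀ * (⟪toL2 F K c₀ Y, DeltaEta F n K c₀ U₀ (toL2 F K c₀ Y)⟫_ℂ).re := by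
  have hstar : star Y = Y := funext fun b => (hY b).1.eq
  have hc₀ : (c₀ : ℝ) ≠ 0 := (Fact.out : 0 < c₀).ne'
  have hη : (eta F n K : ℝ) ≠ 0 := (eta_pos F n K).ne'
  rw [iteratedDeriv_two_wilsonAction4_emb15 U₀ hY, inner_toL2_DeltaEta_toL2, hstar,
    show ((-(2 * (c₀ : ℂ)) / (((eta F n K : ℝ) : ℂ)) ^ 2)) = (((-(2 * c₀) / (eta F n K) ^ 2 : ℝ)) : ℂ) by push_cast; ring, Complex.re_ofReal_mul, Complex.conj_re, cη]
  field_simp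

end Summit.QuantumFields.YangMills.Theorems.Prop7SectET3WilsonHessian

end
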